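import Mathlib
import HarnessLib
import Literature.MathematicalPhysics.StatisticalMechanics.RGStepABKM
import Summits.HubbardSuperconductivity.HubbardSuperconductivity.Theorems.ComplexGFFStiffnessHypACumulantIotaStep

/-!
# Crux `HypACumulant`, line `gnv` — the `ι`-symmetric subspaces of the renormalisation-group coordinates

Route `route-HubbardSuperconductivity-ComplexGFFStiffness`, crux items stmt-HubbardSuperconductivity-19154 /
-19155, research stub `stub_gnvOfFrd : TorusFRD 4 → GNV`.  Vocabulary for running [ABKM19] Lemma 12.6
INSIDE the `ι`-symmetric class (`Literature/Dynamics/Hyperbolic/RGFlowStableManifoldInvariant`):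

* `iotaSub 𝔥 R n` — the `ι`-Hamiltonians (`IsIotaHam`: real constant and quadratic, imaginary linear
  coefficients) as a REAL submodule of `HamSpace ℂ d 𝔥 R n`;
* `iotaActSub P k` — the `ι`-symmetric admissible activities (`IsIotaFun`) as a subgroup of `activitySpace P k`;
* closure lemmas: `isIotaHam_zero`, `IsIotaHam.add`, `IsIotaHam.real_smul`, `isIotaHam_stepOpA`,
  `isIotaHam_stepOpAInv` (the linear step `A_k` and its inverse, real `γ`), `isIotaFun_mulExt`,
  `isIotaFun_restrictConn`.

All proved; no `sorry`.

## References
* S. Adams, S. Buchholz, R. Kotecký, S. Müller, arXiv:1910.13564, Ch. 6.2, Theorem 6.8 (6.56), Ch. 12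
  [AdamsBuchholzKoteckyMuller2019].
-/

noncomputable section

-- `Summit.<Summit>.<Problem>`: single-conjunct summit, the duplicate component is mandated (D-0017).
set_option linter.dupNamespace false

namespace Summit.HubbardSuperconductivity.HubbardSuperconductivity.Theorems.ComplexGFF

open scoped BigOperators ComplexConjugate
open Real Set Finset MeasureTheory
open Literature.MathematicalPhysics.StatisticalMechanics.GradientRG
open Literature.MathematicalPhysics.StatisticalMechanics.GradientFRD
  (fourierCoeff cExt cExt_of_mem IsElliptic IsUnitSymm InShell iterDiff supNorm conv ellOp isElliptic_one)
open Literature.MathematicalPhysics.StatisticalMechanics.TorusPolymer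
  (IsPolymer numBlocks blockOf boxCorner isPolymer_blockOf isConn_blockOf)
open Literature.Barriers.CriticalPhenomena.LongRangePhi4.Polymer (IsConn components)
open Literature.MathematicalPhysics.QuantumFieldTheory
open Literature.Dynamics.Hyperbolic

variable {d M : ℕ} [NeZero M]

/-! ## The `ι`-symmetric subspaces and closure lemmas -/

/-- The zero Hamiltonian is an `ι`-Hamiltonian. -/
theorem isIotaHam_zero : IsIotaHam (0 : RelevantHamiltonian ℂ d) :=
  ⟨fun _ => by simp, fun _ => by simp, fun _ => by simp⟩

/-- `ι`-Hamiltonians are closed under addition. -/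
theorem IsIotaHam.add {H H' : RelevantHamiltonian ℂ d} (hH : IsIotaHam H) (hH' : IsIotaHam H') :
    IsIotaHam (H + H') :=
  iotaCoeff_add hH.1 hH.2.1 hH.2.2 hH'.1 hH'.2.1 hH'.2.2

/-- `ι`-Hamiltonians are closed under REAL scalar multiplication. -/
theorem IsIotaHam.real_smul {H : RelevantHamiltonian ℂ d} (hH : IsIotaHam H) (r : ℝ) :
    IsIotaHam (r • H) := by
  have h : r • H = (r : ℂ) • H := by funext ι; simp [Complex.real_smul]
  rw [h]
  exact iotaCoeff_smul r hH.1 hH.2.1 hH.2.2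

/-- **The `ι`-symmetric relevant Hamiltonians** as a real submodule of the Banach space of relevant
Hamiltonians (scale weights `𝔥, R, n`). -/
def iotaSub (𝔥 R : ℝ) (n : ℕ) : Submodule ℝ (HamSpace ℂ d 𝔥 R n) where
  carrier := {x | IsIotaHam (HamSpace.toHam x)}
  add_mem' := fun {x y} hx hy => by
    show IsIotaHam (HamSpace.toHam (x + y)); rw [map_add]; exact IsIotaHam.add hx hy
  zero_mem' := by show IsIotaHam (HamSpace.toHam 0); rw [map_zero]; exact isIotaHam_zero
  smul_mem' := fun r x hx => by
    show IsIotaHam (HamSpace.toHam (r • x)); rw [map_smul]; exact IsIotaHam.real_smul hx r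

/-- Membership in `iotaSub`. -/
theorem mem_iotaSub {𝔥 R : ℝ} {n : ℕ} {x : HamSpace ℂ d 𝔥 R n} :
    x ∈ iotaSub (d := d) 𝔥 R n ↔ IsIotaHam (HamSpace.toHam x) := Iff.rfl

/-- **The `ι`-symmetric admissible activities** as a subgroup of `activitySpace P k`. -/
def iotaActSub (P : NormParams d M) (k : ℕ) : AddSubgroup (activitySpace P k) where
  carrier := {K | IsIotaFun ((K : activitySpace P k) : Finset (Fin d → ZMod M) → ((Fin d → ZMod M) → ℝ) → ℂ)}
  add_mem' := fun {K K'} hK hK' => by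
    intro X φ
    show ((K + K' : activitySpace P k) : Finset (Fin d → ZMod M) → ((Fin d → ZMod M) → ℝ) → ℂ) X (-φ) = _
    simp only [Submodule.coe_add, Pi.add_apply, map_add, hK X φ, hK' X φ]
  zero_mem' := by intro X φ; simp
  neg_mem' := fun {K} hK => by
    intro X φ
    show ((-K : activitySpace P k) : Finset (Fin d → ZMod M) → ((Fin d → ZMod M) → ℝ) → ℂ) X (-φ) = _
    simp only [Submodule.coe_neg, Pi.neg_apply, map_neg, hK X φ]

/-- `A_k` (real `γ`) preserves `ι`-Hamiltonians. -/
theorem isIotaHam_stepOpA (γ : quadIndex d → ℝ) {H : RelevantHamiltonian ℂ d} (hH : IsIotaHam H) :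
    IsIotaHam (stepOpA γ H) := by
  refine ⟨fun u => ?_, fun α => hH.2.1 α, fun q => hH.2.2 q⟩
  show conj (H (Sum.inl ()) + ∑ q : quadIndex d, (γ q : ℝ) • H (Sum.inr (Sum.inr q))) = _
  rw [map_add, map_sum, hH.1]
  congr 1
  exact Finset.sum_congr rfl fun q _ => by rw [Complex.real_smul, map_mul, Complex.conj_ofReal, hH.2.2 q]

/-- `A_k⁻¹` (real `γ`) preserves `ι`-Hamiltonians. -/
theorem isIotaHam_stepOpAInv (γ : quadIndex d → ℝ) {H : RelevantHamiltonian ℂ d} (hH : IsIotaHam H) :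
    IsIotaHam (stepOpAInv γ H) := by
  refine ⟨fun u => ?_, fun α => hH.2.1 α, fun q => hH.2.2 q⟩
  show conj (H (Sum.inl ()) - ∑ q : quadIndex d, (γ q : ℝ) • H (Sum.inr (Sum.inr q))) = _
  rw [map_sub, map_sum, hH.1]
  congr 1
  exact Finset.sum_congr rfl fun q _ => by rw [Complex.real_smul, map_mul, Complex.conj_ofReal, hH.2.2 q]

omit [NeZero M] in
/-- The multiplicative extension of an `ι`-symmetric activity is `ι`-symmetric. -/
theorem isIotaFun_mulExt {K : Finset (Fin d → ZMod M) → ((Fin d → ZMod M) → ℝ) → ℂ} (hK : IsIotaFun K) :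
    IsIotaFun (mulExt K) := fun X φ => by
  rw [mulExt_apply, mulExt_apply, map_prod]
  exact Finset.prod_congr rfl fun Y _ => hK Y φ

/-- Restriction to connected polymers preserves `ι`-symmetry. -/
theorem isIotaFun_restrictConn {s : ℕ} {K : Finset (Fin d → ZMod M) → ((Fin d → ZMod M) → ℝ) → ℂ}
    (hK : IsIotaFun K) : IsIotaFun (restrictConn s K) := fun X φ => by
  by_cases hX : IsPolymer s X ∧ IsConn X
  · rw [restrictConn_of_conn hX.1 hX.2]; exact hK X φ
  · rw [restrictConn_of_not hX]; simp

end Summit.HubbardSuperconductivity.HubbardSuperconductivity.Theorems.ComplexGFF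

end
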